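import Summits.QuantumFields.YangMills.Theorems.PencilRigidityHypercubicLimitRpBlockBoundarySlice
import Summits.QuantumFields.YangMills.Theorems.PencilRigidityHypercubicLimitRpBlockSameLimitSmeared
import HarnessLib

/-!
# Crux `HypercubicLimit` (stmt-QuantumFields-16154), line `peel-and-disseminate`: (R1) helpers — boundary slice and same limit with a free decay order

Support file (c3 seat, `--supports stmt-QuantumFields-16154`, registered sub-goal `rh_sameLimit`) for the piece
(R1) `stub_reflHermRP` of the line (hermiticity and reflection positivity of the one-field limits of the host
closure; main file `MirrorModularBoostsHypercubicLimitPeelReflHermRP.lean`, RP-adapted family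
`MirrorModularBoostsHypercubicLimitPeelRpFamDefs.lean`).  The RP-adapted lattice family of a `SoftData` scheme
differs from the canonical renormalised plane-string family by (i) constant shifts `c_q` of the evaluation
points, `‖c_q‖ ≤ 2a`, and (ii) the boundary time slice `x₀ = -L` of the spatial corners.  For ABSTRACT real
weights `W` with sup bound `Mⁿ` on the torus of half-side `L`, spacing `a`:
* §1 `rh_slice_abs_mul_norm_le`, `rh_boundarySlice`: the slice is `O(a^{E+1})` for EVERY order `E` — the
  host blocks `slice_abs_mul_norm_le` / `rpBlock_boundarySlice` (crux stmt-QuantumFields-8646, c1 seat) are the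
  case `E = 0`; Schwartz decay of order `10n+1+E` at physical distance `≥ a L ≥ a⁻¹` gives the factor `a^{E+1}`;
* §2 `rh_sameLimit`: after a renormalisation `λ ≥ 0` with `λⁿ a^E ≤ 1`, the RP-adapted minus the canonical
  smeared sum is `O(a)` on `⁰𝒮`: the shift part by the mean value theorem at intermediate points (real and
  imaginary parts; `∂_c F ∈ ⁰𝒮`, `|∂_c F|_s ≤ ‖c‖ |F|_{s+1}`, closed by the shifted uniform bound), the slice
  part by §1 for the translate `F(· + c)` (the host's `rpBlock_sameLimitSmeared` is `λ = 1`, `E = 0`).  With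
  `E = Q n` this absorbs `PolyRenorm`'s `λ_k ≤ a_k^{-Q}`, so the two families have the same limit.

Refs: OsterwalderSchrader1973 §§3–4; OsterwalderSchrader1975 §2 (`⁰𝒮`, E0′); GlimmJaffe1987 §6.1;
`PencilRigidityHypercubicLimitDefs.lean` §7.
-/

set_option autoImplicit false
noncomputable section
open scoped SchwartzMap
open MeasureTheory Filter Topology
open Literature.MathematicalPhysics.AQFT Literature.MathematicalPhysics.QuantumLattice
open Literature.MathematicalPhysics.QuantumFieldTheory
open Literature.Probability.LatticeModels (box Site)
open Summit.QuantumFields.YangMills.Cruxes.HypercubicLimit.ConditionalMeanTelescoping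

namespace Summit.QuantumFields.YangMills.Cruxes.HypercubicLimit.PeelAndDisseminate

/-! ## §1 The boundary slice is `O(a^{E+1})` by Schwartz decay of order `10n+1+E` -/

/-- **Per-point bound in the far zone, any order.** If `‖y‖ ≥ a⁻¹` for the physical point
`y = (a • siteToE (x i))ᵢ` (`0 < a ≤ 1`) and `|w| ≤ Mⁿ`, then for every `E`,
`|w| ‖F y‖ ≤ Mⁿ 2^{6n} |F|_{10n+1+E,0} · a^{E+1} · ∏ᵢ a⁴ (1 + a‖xᵢ‖)⁻⁶` (Schwartz decay of order `10n+1+E`;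
the case `E = 0` is the host's `slice_abs_mul_norm_le`). [folklore] -/
theorem rh_slice_abs_mul_norm_le {n : ℕ} (E : ℕ) {M a : ℝ} (hM : 0 ≤ M) (ha : 0 < a) (ha1 : a ≤ 1)
    (F : 𝓢((Fin n → EuclideanSpace ℝ (Fin 4)), ℂ)) (x : Fin n → Site 4) {w : ℝ} (hw : |w| ≤ M ^ n)
    (hy : a⁻¹ ≤ ‖(fun i => a • siteToE (x i) : Fin n → EuclideanSpace ℝ (Fin 4))‖) :
    |w| * ‖F (fun i => a • siteToE (x i))‖ ≤
      M ^ n * 2 ^ (6 * n) * SchwartzMap.seminorm ℂ (10 * n + 1 + E) 0 F * a ^ (E + 1) *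
        ∏ i, (a ^ 4 * ((1 + a * ‖x i‖) ^ 6)⁻¹) := by
  set y : Fin n → EuclideanSpace ℝ (Fin 4) := fun i => a • siteToE (x i) with hy_def
  set t := ‖y‖ with ht
  set S := SchwartzMap.seminorm ℂ (10 * n + 1 + E) 0 F with hS
  have hS0 : 0 ≤ S := apply_nonneg _ _
  have hainv : (1 : ℝ) ≤ a⁻¹ := one_le_inv_iff₀.2 ⟨ha, ha1⟩
  have ht1 : 1 ≤ t := hainv.trans hy
  have htpos : 0 < t := by linarith
  have hat : 1 ≤ a * t := by
    have := mul_le_mul_of_nonneg_left hy ha.le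
    rwa [mul_inv_cancel₀ ha.ne'] at this
  -- Schwartz decay of order `10 n + 1 + E`
  have hdecay : t ^ (10 * n + 1 + E) * ‖F y‖ ≤ S :=
    Summit.QuantumFields.YangMills.Theorems.OSLegsFromFemtoAndGap.pow_mul_norm_le_seminorm F (10 * n + 1 + E) y
  have h1t : (1 + t) ^ (6 * n) ≤ (2 : ℝ) ^ (6 * n) * t ^ (6 * n) := by
    rw [← mul_pow]; exact pow_le_pow_left₀ (by positivity) (by linarith) _
  have h2t : (1 : ℝ) ≤ (a * t) ^ (4 * n + 1 + E) := one_le_pow₀ hat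
  have hmain : ‖F y‖ * (1 + t) ^ (6 * n) ≤ 2 ^ (6 * n) * a ^ (4 * n + 1 + E) * S := by
    calc ‖F y‖ * (1 + t) ^ (6 * n) ≤ ‖F y‖ * ((2 : ℝ) ^ (6 * n) * t ^ (6 * n)) := by gcongr
      _ ≤ ‖F y‖ * ((2 : ℝ) ^ (6 * n) * t ^ (6 * n)) * (a * t) ^ (4 * n + 1 + E) :=
          le_mul_of_one_le_right (by positivity) h2t
      _ = 2 ^ (6 * n) * a ^ (4 * n + 1 + E) * (t ^ (10 * n + 1 + E) * ‖F y‖) := by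
          rw [mul_pow]; ring
      _ ≤ 2 ^ (6 * n) * a ^ (4 * n + 1 + E) * S := by gcongr
  have hq : 0 < (1 + t) ^ (6 * n) := by positivity
  have hP : ((1 + t) ^ (6 * n))⁻¹ ≤ ∏ i, ((1 + a * ‖x i‖) ^ 6)⁻¹ := by
    have := Summit.QuantumFields.YangMills.Theorems.OSLegsFromFemtoAndGap.inv_one_add_norm_pow_le_prod
      ha.le x y (fun i =>
        Summit.QuantumFields.YangMills.Theorems.OSLegsFromFemtoAndGap.mul_norm_le_norm_smul_siteToE
          ha.le (x i)) 6
    rw [inv_pow, ← pow_mul] at this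
    exact this
  have hP0 : 0 ≤ ∏ i, ((1 + a * ‖x i‖) ^ 6)⁻¹ := Finset.prod_nonneg fun i _ => by positivity
  have h4 : a ^ (4 * n) * ∏ i, ((1 + a * ‖x i‖) ^ 6)⁻¹ = ∏ i, (a ^ 4 * ((1 + a * ‖x i‖) ^ 6)⁻¹) := by
    rw [Finset.prod_mul_distrib, Finset.prod_const, Finset.card_univ, Fintype.card_fin, pow_mul]
  have hFy : ‖F y‖ ≤ 2 ^ (6 * n) * a ^ (4 * n + 1 + E) * S * ((1 + t) ^ (6 * n))⁻¹ := by
    rw [← div_eq_mul_inv, le_div_iff₀ hq]; exact hmain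
  have hwn : 0 ≤ |w| := abs_nonneg _
  have hpow : a ^ (4 * n + 1 + E) = a ^ (E + 1) * a ^ (4 * n) := by
    rw [← pow_add]; congr 1; omega
  calc |w| * ‖F y‖ ≤ M ^ n * (2 ^ (6 * n) * a ^ (4 * n + 1 + E) * S * ((1 + t) ^ (6 * n))⁻¹) := by gcongr
    _ ≤ M ^ n * (2 ^ (6 * n) * a ^ (4 * n + 1 + E) * S * ∏ i, ((1 + a * ‖x i‖) ^ 6)⁻¹) := by gcongr
    _ = M ^ n * 2 ^ (6 * n) * S * a ^ (E + 1) * (a ^ (4 * n) * ∏ i, ((1 + a * ‖x i‖) ^ 6)⁻¹) := by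
        rw [hpow]; ring
    _ = M ^ n * 2 ^ (6 * n) * S * a ^ (E + 1) * ∏ i, (a ^ 4 * ((1 + a * ‖x i‖) ^ 6)⁻¹) := by rw [h4]

/-- **The boundary slice is `O(a^{E+1})`.** For abstract real weights with sup bound `Mⁿ`, spacing
`0 < a ≤ 1`, half-side `L ≥ a⁻²` and a sub-domain `D` of the box whose complement lies in the far zone
(`‖x l‖ ≥ L` for some `l`), for every `E`:
`‖∑_{x ∈ box ∖ D} W(x) F(a x)‖ ≤ Mⁿ · 2^{16n+2} · Zⁿ · |F|_{10n+1+E,0} · a^{E+1}`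
(the host's `rpBlock_boundarySlice` is `E = 0`; the extra Schwartz decay absorbs any polynomial
renormalisation `λ_k ≤ a_k^{-Q}`). [folklore] -/
theorem rh_boundarySlice (n L E : ℕ) (M a : ℝ) (W : (Fin n → Site 4) → ℝ) (D : Finset (Fin n → Site 4))
    (F : 𝓢((Fin n → EuclideanSpace ℝ (Fin 4)), ℂ)) (hM : 0 ≤ M) (hW : ∀ x, |W x| ≤ M ^ n) (ha : 0 < a)
    (ha1 : a ≤ 1) (hLa : a⁻¹ * a⁻¹ ≤ L)
    (hfar : ∀ x ∈ Fintype.piFinset (fun _ : Fin n => box 4 L), x ∉ D → ∃ l, (L : ℝ) ≤ ‖x l‖) :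
    ‖∑ x ∈ Fintype.piFinset (fun _ : Fin n => box 4 L) \ D,
        ((W x : ℝ) : ℂ) * F (fun l => a • siteToE (x l))‖ ≤
      M ^ n * 2 ^ (16 * n + 2) * (81 * ∑' m : ℕ, (((m : ℝ) + 1) ^ 2)⁻¹) ^ n *
        SchwartzMap.seminorm ℂ (10 * n + 1 + E) 0 F * a ^ (E + 1) := by
  classical
  set B := Fintype.piFinset (fun _ : Fin n => box 4 L) with hB
  set S := SchwartzMap.seminorm ℂ (10 * n + 1 + E) 0 F with hS
  set Z : ℝ := 81 * ∑' m : ℕ, (((m : ℝ) + 1) ^ 2)⁻¹ with hZ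
  set g : (Fin n → Site 4) → ℝ := fun x => ∏ i, (a ^ 4 * ((1 + a * ‖x i‖) ^ 6)⁻¹) with hg
  have hS0 : 0 ≤ S := apply_nonneg _ _
  have hg0 : ∀ x, 0 ≤ g x := fun x => Finset.prod_nonneg fun i _ => by positivity
  have hK0 : 0 ≤ M ^ n * 2 ^ (6 * n) * S * a ^ (E + 1) := by positivity
  have hpt : ∀ x ∈ B \ D, ‖((W x : ℝ) : ℂ) * F (fun l => a • siteToE (x l))‖ ≤
      M ^ n * 2 ^ (6 * n) * S * a ^ (E + 1) * g x := by
    intro x hx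
    rw [Finset.mem_sdiff] at hx
    obtain ⟨l, hl⟩ := hfar x hx.1 hx.2
    rw [norm_mul, Complex.norm_real, Real.norm_eq_abs]
    exact rh_slice_abs_mul_norm_le E hM ha ha1 F x (hW x) (slice_inv_le_norm ha hLa x hl)
  have h2pow : (2 : ℝ) ^ (6 * n) ≤ 2 ^ (16 * n + 2) := pow_le_pow_right₀ (by norm_num) (by omega)
  calc ‖∑ x ∈ B \ D, ((W x : ℝ) : ℂ) * F (fun l => a • siteToE (x l))‖
      ≤ ∑ x ∈ B \ D, ‖((W x : ℝ) : ℂ) * F (fun l => a • siteToE (x l))‖ := norm_sum_le _ _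
    _ ≤ ∑ x ∈ B \ D, M ^ n * 2 ^ (6 * n) * S * a ^ (E + 1) * g x := Finset.sum_le_sum hpt
    _ ≤ ∑ x ∈ B, M ^ n * 2 ^ (6 * n) * S * a ^ (E + 1) * g x :=
        Finset.sum_le_sum_of_subset_of_nonneg Finset.sdiff_subset fun x _ _ =>
          mul_nonneg hK0 (hg0 x)
    _ = M ^ n * 2 ^ (6 * n) * S * a ^ (E + 1) * ∑ x ∈ B, g x := by rw [Finset.mul_sum]
    _ ≤ M ^ n * 2 ^ (6 * n) * S * a ^ (E + 1) * Z ^ n := by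
        refine mul_le_mul_of_nonneg_left ?_ hK0
        rw [hZ, hg, hB]
        exact Summit.QuantumFields.YangMills.Theorems.OSLegsFromFemtoAndGap.sum_prod_decay_le ha ha1
          (le_refl 6) (box 4 L) n
    _ ≤ M ^ n * 2 ^ (16 * n + 2) * S * a ^ (E + 1) * Z ^ n := by gcongr
    _ = M ^ n * 2 ^ (16 * n + 2) * Z ^ n * S * a ^ (E + 1) := by ring

/-! ## §2 RP-adapted minus canonical is `O(a)` after renormalisation -/

/-- **Same limit after renormalisation.** For abstract real weights `W` with sup bound `Mⁿ`, a
renormalisation `λ ≥ 0` with `λⁿ a^E ≤ 1`, spacing `0 < a ≤ 1/2`, half-side `L ≥ a⁻²`, a sub-domain `D` of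
the box whose complement lies in the far zone, a constant shift `c` with `‖c l‖ ≤ 2a`, `F ∈ ⁰𝒮ₙ`, and the
RENORMALISED smeared bound `λⁿ ‖∑_{x ∈ box} W(x) G(y(x))‖ ≤ Φ |G|_s` for every `G ∈ ⁰𝒮ₙ` and every evaluation
map `y` within `2a` of the scaled sites:
`λⁿ ‖∑_{x∈D} W F(a x + c) − ∑_{x∈box} W F(a x)‖ ≤ a (4 Φ |F|_{s+1} + Mⁿ 2^{16n+2} Zⁿ 4^{10n+1+E} |F|_{10n+1+E})`
— the shift part by the mean value theorem at intermediate points (real and imaginary parts,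
`∂_c F ∈ ⁰𝒮ₙ`, `|∂_c F|_s ≤ ‖c‖ |F|_{s+1}`), the slice part by `rh_boundarySlice` for the translate
`F(· + c)`, the factor `λⁿ` being absorbed by `a^E`.  (The host's `rpBlock_sameLimitSmeared` is the
un-renormalised case `λ = 1`, `E = 0`.) [folklore] -/
theorem rh_sameLimit :
    ∀ (n L s E : ℕ) (M a lam Φ : ℝ) (W : (Fin n → Site 4) → ℝ) (D : Finset (Fin n → Site 4))
      (c : Fin n → EuclideanSpace ℝ (Fin 4)) (F : 𝓢((Fin n → EuclideanSpace ℝ (Fin 4)), ℂ)),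
      0 ≤ M → (∀ x, |W x| ≤ M ^ n) → 0 < a → a ≤ 1 / 2 → a⁻¹ * a⁻¹ ≤ L → 0 ≤ Φ → 0 ≤ lam →
      lam ^ n * a ^ E ≤ 1 → D ⊆ Fintype.piFinset (fun _ : Fin n => box 4 L) →
      (∀ x ∈ Fintype.piFinset (fun _ : Fin n => box 4 L), x ∉ D → ∃ l, (L : ℝ) ≤ ‖x l‖) →
      (∀ l, ‖c l‖ ≤ 2 * a) → IsOffDiagonal F →
      (∀ (y : (Fin n → Site 4) → (Fin n → EuclideanSpace ℝ (Fin 4))),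
        (∀ x l, ‖y x l - a • siteToE (x l)‖ ≤ 2 * a) →
          ∀ G : 𝓢((Fin n → EuclideanSpace ℝ (Fin 4)), ℂ), IsOffDiagonal G →
            lam ^ n * ‖∑ x ∈ Fintype.piFinset (fun _ : Fin n => box 4 L), ((W x : ℝ) : ℂ) * G (y x)‖ ≤
              Φ * schwartzNorm s G) →
      lam ^ n * ‖(∑ x ∈ D, ((W x : ℝ) : ℂ) * F (fun l => a • siteToE (x l) + c l)) -
          ∑ x ∈ Fintype.piFinset (fun _ : Fin n => box 4 L),
            ((W x : ℝ) : ℂ) * F (fun l => a • siteToE (x l))‖ ≤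
        a * (4 * Φ * schwartzNorm (s + 1) F +
          M ^ n * 2 ^ (16 * n + 2) * (81 * ∑' j : ℕ, (((j : ℝ) + 1) ^ 2)⁻¹) ^ n * 4 ^ (10 * n + 1 + E) *
            schwartzNorm (10 * n + 1 + E) F) := by
  intro n L s E M a lam Φ W D c F hM hW ha ha2 hLa hΦ hlam hlamE hD hfar hc hF hU
  classical
  set B := Fintype.piFinset (fun _ : Fin n => box 4 L) with hB
  set ax : (Fin n → Site 4) → (Fin n → EuclideanSpace ℝ (Fin 4)) := fun x l => a • siteToE (x l) with hax
  set Z : ℝ := 81 * ∑' j : ℕ, (((j : ℝ) + 1) ^ 2)⁻¹ with hZ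
  obtain ⟨F', hF'⟩ : ∃ F' : 𝓢((Fin n → EuclideanSpace ℝ (Fin 4)), ℂ), F' = LineDeriv.lineDerivOp c F := ⟨_, rfl⟩
  obtain ⟨Fc, hFc⟩ : ∃ Fc : 𝓢((Fin n → EuclideanSpace ℝ (Fin 4)), ℂ),
      Fc = SchwartzMap.compSubConstCLM ℂ (-c) F := ⟨_, rfl⟩
  have ha1 : a ≤ 1 := ha2.trans (by norm_num)
  have hZ0 : 0 ≤ Z := mul_nonneg (by norm_num) (tsum_nonneg fun j => by positivity)
  have hsN0 : 0 ≤ schwartzNorm (s + 1) F := schwartzNorm_nonneg _ _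
  have hlamn : 0 ≤ lam ^ n := pow_nonneg hlam n
  have hcn : ‖c‖ ≤ 2 * a := (pi_norm_le_iff_of_nonneg (by positivity)).2 hc
  have hcn1 : ‖-c‖ ≤ 1 := by rw [norm_neg]; linarith
  change lam ^ n * ‖(∑ x ∈ D, ((W x : ℝ) : ℂ) * F (ax x + c)) - ∑ x ∈ B, ((W x : ℝ) : ℂ) * F (ax x)‖ ≤
    a * (4 * Φ * schwartzNorm (s + 1) F +
      M ^ n * 2 ^ (16 * n + 2) * Z ^ n * 4 ^ (10 * n + 1 + E) * schwartzNorm (10 * n + 1 + E) F)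
  have hre : ∀ x : Fin n → Site 4, ∃ τ ∈ Set.Ioo (0 : ℝ) 1,
      (F (ax x + c)).re - (F (ax x)).re = (F' (ax x + τ • c)).re := fun x =>
    hF' ▸ Summit.QuantumFields.YangMills.Theorems.OSLegsFromFemtoAndGap.exists_re_sub_eq_re_lineDeriv F _ c
  have him : ∀ x : Fin n → Site 4, ∃ τ ∈ Set.Ioo (0 : ℝ) 1,
      (F (ax x + c)).im - (F (ax x)).im = (F' (ax x + τ • c)).im := fun x =>
    hF' ▸ Summit.QuantumFields.YangMills.Theorems.OSLegsFromFemtoAndGap.exists_im_sub_eq_im_lineDeriv F _ c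
  choose τ₁ hτ₁ hτ₁eq using hre
  choose τ₂ hτ₂ hτ₂eq using him
  have hFc_apply : ∀ x, Fc (ax x) = F (ax x + c) := fun x => by
    rw [hFc, SchwartzMap.compSubConstCLM_apply, sub_neg_eq_add]
  -- (1) the decomposition into a shift part over the box and a slice part
  have hdecomp : (∑ x ∈ D, ((W x : ℝ) : ℂ) * F (ax x + c)) - ∑ x ∈ B, ((W x : ℝ) : ℂ) * F (ax x) =
      (∑ x ∈ B, ((W x : ℝ) : ℂ) * (F (ax x + c) - F (ax x))) -
        ∑ x ∈ B \ D, ((W x : ℝ) : ℂ) * Fc (ax x) := by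
    have hsplit := Finset.sum_sdiff (f := fun x => ((W x : ℝ) : ℂ) * F (ax x + c)) hD
    simp only [hFc_apply, mul_sub, Finset.sum_sub_distrib]
    rw [← hsplit]
    ring
  -- (2) the shift part: the intermediate points are within `2a` of the scaled sites
  have hnear : ∀ (τ : (Fin n → Site 4) → ℝ), (∀ x, τ x ∈ Set.Ioo (0 : ℝ) 1) →
      ∀ x l, ‖(ax x + τ x • c) l - a • siteToE (x l)‖ ≤ 2 * a := by
    intro τ hτ x l
    have h1 : (ax x + τ x • c) l - a • siteToE (x l) = τ x • c l := by
      simp only [hax, Pi.add_apply, Pi.smul_apply, add_sub_cancel_left]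
    rw [h1, norm_smul, Real.norm_of_nonneg (hτ x).1.le]
    calc τ x * ‖c l‖ ≤ 1 * ‖c l‖ := by gcongr; exact (hτ x).2.le
      _ ≤ 2 * a := by rw [one_mul]; exact hc l
  have hF'off : IsOffDiagonal F' := by rw [hF']; exact hF.lineDeriv c
  have hU₁ : lam ^ n * ‖∑ x ∈ B, ((W x : ℝ) : ℂ) * F' (ax x + τ₁ x • c)‖ ≤ Φ * schwartzNorm s F' :=
    hU (fun x => ax x + τ₁ x • c) (hnear τ₁ hτ₁) F' hF'off
  have hU₂ : lam ^ n * ‖∑ x ∈ B, ((W x : ℝ) : ℂ) * F' (ax x + τ₂ x • c)‖ ≤ Φ * schwartzNorm s F' :=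
    hU (fun x => ax x + τ₂ x • c) (hnear τ₂ hτ₂) F' hF'off
  have hsn : schwartzNorm s F' ≤ 2 * a * schwartzNorm (s + 1) F :=
    calc schwartzNorm s F' ≤ ‖c‖ * schwartzNorm (s + 1) F := by
          rw [hF']; exact slS_schwartzNorm_lineDeriv_le s F c
      _ ≤ 2 * a * schwartzNorm (s + 1) F := mul_le_mul_of_nonneg_right hcn hsN0
  have hshift : lam ^ n * ‖∑ x ∈ B, ((W x : ℝ) : ℂ) * (F (ax x + c) - F (ax x))‖ ≤
      2 * Φ * (2 * a * schwartzNorm (s + 1) F) := by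
    set z := ∑ x ∈ B, ((W x : ℝ) : ℂ) * (F (ax x + c) - F (ax x)) with hz
    have hzre : z.re = (∑ x ∈ B, ((W x : ℝ) : ℂ) * F' (ax x + τ₁ x • c)).re := by
      rw [hz, Complex.re_sum, Complex.re_sum]
      refine Finset.sum_congr rfl fun x _ => ?_
      simp only [Complex.mul_re, Complex.ofReal_re, Complex.ofReal_im, zero_mul, sub_zero,
        Complex.sub_re]
      rw [hτ₁eq x]
    have hzim : z.im = (∑ x ∈ B, ((W x : ℝ) : ℂ) * F' (ax x + τ₂ x • c)).im := by
      rw [hz, Complex.im_sum, Complex.im_sum]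
      refine Finset.sum_congr rfl fun x _ => ?_
      simp only [Complex.mul_im, Complex.ofReal_re, Complex.ofReal_im, zero_mul, add_zero,
        Complex.sub_im]
      rw [hτ₂eq x]
    calc lam ^ n * ‖z‖ ≤ lam ^ n * (|z.re| + |z.im|) :=
          mul_le_mul_of_nonneg_left (Complex.norm_le_abs_re_add_abs_im z) hlamn
      _ ≤ lam ^ n * (‖∑ x ∈ B, ((W x : ℝ) : ℂ) * F' (ax x + τ₁ x • c)‖ +
            ‖∑ x ∈ B, ((W x : ℝ) : ℂ) * F' (ax x + τ₂ x • c)‖) := by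
          rw [hzre, hzim]
          exact mul_le_mul_of_nonneg_left
            (add_le_add (Complex.abs_re_le_norm _) (Complex.abs_im_le_norm _)) hlamn
      _ = lam ^ n * ‖∑ x ∈ B, ((W x : ℝ) : ℂ) * F' (ax x + τ₁ x • c)‖ +
            lam ^ n * ‖∑ x ∈ B, ((W x : ℝ) : ℂ) * F' (ax x + τ₂ x • c)‖ := mul_add _ _ _
      _ ≤ Φ * schwartzNorm s F' + Φ * schwartzNorm s F' := add_le_add hU₁ hU₂
      _ ≤ Φ * (2 * a * schwartzNorm (s + 1) F) + Φ * (2 * a * schwartzNorm (s + 1) F) :=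
          add_le_add (mul_le_mul_of_nonneg_left hsn hΦ) (mul_le_mul_of_nonneg_left hsn hΦ)
      _ = 2 * Φ * (2 * a * schwartzNorm (s + 1) F) := by ring
  -- (3) the slice part
  have hslice : lam ^ n * ‖∑ x ∈ B \ D, ((W x : ℝ) : ℂ) * Fc (ax x)‖ ≤
      M ^ n * 2 ^ (16 * n + 2) * Z ^ n *
        (4 ^ (10 * n + 1 + E) * schwartzNorm (10 * n + 1 + E) F) * a := by
    set P := 4 ^ (10 * n + 1 + E) * schwartzNorm (10 * n + 1 + E) F with hP
    have h : ‖∑ x ∈ B \ D, ((W x : ℝ) : ℂ) * Fc (ax x)‖ ≤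
        M ^ n * 2 ^ (16 * n + 2) * Z ^ n * SchwartzMap.seminorm ℂ (10 * n + 1 + E) 0 Fc * a ^ (E + 1) :=
      rh_boundarySlice n L E M a W D Fc hM hW ha ha1 hLa hfar
    have hsemi : SchwartzMap.seminorm ℂ (10 * n + 1 + E) 0 Fc ≤ P := by
      rw [hFc]; exact slS_seminorm_translate_le (10 * n + 1 + E) F hcn1
    have hK0 : 0 ≤ M ^ n * 2 ^ (16 * n + 2) * Z ^ n :=
      mul_nonneg (mul_nonneg (pow_nonneg hM _) (pow_nonneg (by norm_num) _)) (pow_nonneg hZ0 _)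
    have hsF0 : 0 ≤ P := mul_nonneg (pow_nonneg (by norm_num) _) (schwartzNorm_nonneg _ _)
    calc lam ^ n * ‖∑ x ∈ B \ D, ((W x : ℝ) : ℂ) * Fc (ax x)‖
        ≤ lam ^ n * (M ^ n * 2 ^ (16 * n + 2) * Z ^ n * P * a ^ (E + 1)) :=
          mul_le_mul_of_nonneg_left (h.trans (mul_le_mul_of_nonneg_right
            (mul_le_mul_of_nonneg_left hsemi hK0) (pow_nonneg ha.le _))) hlamn
      _ = (lam ^ n * a ^ E) * (M ^ n * 2 ^ (16 * n + 2) * Z ^ n * P * a) := by rw [pow_succ]; ring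
      _ ≤ 1 * (M ^ n * 2 ^ (16 * n + 2) * Z ^ n * P * a) :=
          mul_le_mul_of_nonneg_right hlamE (mul_nonneg (mul_nonneg hK0 hsF0) ha.le)
      _ = _ := one_mul _
  -- (4) assemble
  rw [hdecomp]
  calc lam ^ n * ‖(∑ x ∈ B, ((W x : ℝ) : ℂ) * (F (ax x + c) - F (ax x))) -
          ∑ x ∈ B \ D, ((W x : ℝ) : ℂ) * Fc (ax x)‖
      ≤ lam ^ n * (‖∑ x ∈ B, ((W x : ℝ) : ℂ) * (F (ax x + c) - F (ax x))‖ +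
          ‖∑ x ∈ B \ D, ((W x : ℝ) : ℂ) * Fc (ax x)‖) :=
        mul_le_mul_of_nonneg_left (norm_sub_le _ _) hlamn
    _ = lam ^ n * ‖∑ x ∈ B, ((W x : ℝ) : ℂ) * (F (ax x + c) - F (ax x))‖ +
          lam ^ n * ‖∑ x ∈ B \ D, ((W x : ℝ) : ℂ) * Fc (ax x)‖ := mul_add _ _ _
    _ ≤ 2 * Φ * (2 * a * schwartzNorm (s + 1) F) +
          M ^ n * 2 ^ (16 * n + 2) * Z ^ n *
            (4 ^ (10 * n + 1 + E) * schwartzNorm (10 * n + 1 + E) F) * a :=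
        add_le_add hshift hslice
    _ = a * (4 * Φ * schwartzNorm (s + 1) F +
          M ^ n * 2 ^ (16 * n + 2) * Z ^ n * 4 ^ (10 * n + 1 + E) * schwartzNorm (10 * n + 1 + E) F) := by
        ring

end Summit.QuantumFields.YangMills.Cruxes.HypercubicLimit.PeelAndDisseminate

end
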